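import Summits.AtomisticToContinuum.HydrodynamicLimit.Theorems.ImplosionDichotomyPolynomialCompressionUniquenessIdentity

/-!
# The symmetrised energy identity of the frozen-coefficient linearised hard-sphere Euler operator

Helper file for the line `log-lipschitz-budget` of the crux
`ImplosionDichotomy.PolynomialCompression` (stub `stub_logBudgetShadowing`: hard-sphere solutions
shadow the ideal-gas implosion; energy method at every derivative level). Fix ONE classical
solution `V = (ρ, u, θ)` of the hard-sphere Euler system on `[0, T) × 𝕋³` and a function `ζ`
smooth on an open set `J ⊆ ℝ` containing the values of `ρ`; put `γ = ζ + id·ζ'`,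
`A = θ γ(ρ)/ρ`, `B = 3ρ/(2θ)`. When the pressure field is `p = ρ θ ζ(ρ)` (`∂_ρ p = θ γ(ρ)`,
`∂_θ p = ρ ζ(ρ)`; `UniquenessPrimitive`: `D_t ρ = -ρ div u`, `ρ D_t u = -∇p`,
`D_t θ = -(2/3) θ ζ(ρ) div u`, `D_t = ∂ₜ + u·∇`) the linearisation of the primitive system around
`V` with FROZEN coefficients acts on a triple of fields `W = (α, w, β)` (density-, velocity-,
temperature-like) by

* `F_ρ W = ∂ₜα + u·∇α + ρ div w`,
* `(F_u W)ⱼ = ∂ₜwⱼ + u·∇wⱼ + A ∂ⱼα + ζ(ρ) ∂ⱼβ`,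
* `F_θ W = ∂ₜβ + u·∇β + (2/3) θ ζ(ρ) div w`,

and the weights `A, B` symmetrise it (`A ρ = θ γ(ρ)`, `2 B θ = 3 ρ`).
`hsEuler_frozen_energy_identity` is the resulting POINTWISE energy identity, for ARBITRARY jointly
smooth fields `α, β : [0, T) × 𝕋³ → ℝ`, `w : [0, T) × 𝕋³ → ℝ³` (no equation is assumed for them)
and arbitrary smooth `ζ` (the pressure law itself is NOT used — only the mass equation and
`ρ, θ > 0` of the solution enter): with

* energy density `e = ½ (A α² + ρ |w|² + B β²)`,
* fluxes `Φᵢ = ½ (A uᵢ α² + ρ uᵢ |w|² + B uᵢ β²) + θ γ(ρ) α wᵢ + ρ ζ(ρ) β wᵢ`,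

`∂ₜe + Σᵢ ∂ᵢΦᵢ = Q + A α F_ρW + ρ Σⱼ wⱼ (F_uW)ⱼ + B β F_θW` on `[0, T) × 𝕋³`, where the three
`F`'s are WRITTEN OUT (notation, not hypotheses) and `Q` is the explicit quadratic form in
`(α, w, β)` with the zero-order coefficients `½ (D_t A + A div u)` (on `α²`),
`½ (D_t B + B div u)` (on `β²`) and the cross corrections `∂ᵢ(θ γ(ρ)) α wᵢ + ∂ᵢ(ρ ζ(ρ)) β wᵢ`;
the coefficient `½ (∂ₜρ + div(ρ u))` of `|w|²` vanishes by the mass equation and is dropped.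
No derivative of `α, w, β` occurs on the right-hand side outside the three `F`'s: the principal
part is a total divergence because of the two symmetriser relations.

Uses. `W = V - V'` for a second solution `V'` of the SAME system: `F W` is bilinear in `W` and
`∇V'` and one recovers the relative-energy balance of `UniquenessIdentity`; `W = V - V'` for a
solution `V'` of the system with ANOTHER pressure law `ρ θ ζ₂(ρ)`: `F W` is in addition forced by
the equation-of-state defect `ζ(ρ) - ζ₂(ρ')` (level `0` of the shadowing estimate);
`W = ∂ˣ(V - V')`: the higher levels, with commutator forcing. Calculus exactly as in
`UniquenessIdentity` (product rules along coordinate lines and time slices from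
`UniquenessPrimitive`); algebra by `linear_combination` with the mass equation
`hsEuler_density_eq` and the two symmetriser relations.

The zero-order coefficients of `Q` along a solution whose pressure IS `ρ θ ζ(ρ)` are evaluated in
`WeightTransport` (`hsEuler_weightA_transport`, `hsEuler_weightB_transport`,
`hsEuler_coeffRho_partialDeriv`, `hsEuler_coeffTheta_partialDeriv`): each is a zero-order quantity
times `div u`, `∇θ` or `∇ρ` (Type I); the combination is `RelativeEnergyTwoEos`.
-/

noncomputable section

namespace Summit.AtomisticToContinuum.HydrodynamicLimit.Theorems

open Set Filter Topology MeasureTheory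
open scoped ContDiff
open Literature.MathematicalPhysics.KineticTheory Literature.Analysis.FunctionSpaces

section Frozen

/-- **Symmetrised energy identity for the frozen-coefficient linearised hard-sphere Euler
operator, pointwise.** For a classical hard-sphere–Euler solution `(ρ, u, θ)` on `[0, T) × 𝕋³`,
ANY function `ζ` smooth on an open set `J` containing the values of `ρ` (weights
`A = θ (ζ(ρ) + ρ ζ'(ρ))/ρ`, `B = 3ρ/(2θ)`; in the application `ρ θ ζ(ρ)` is the pressure, which is
not needed for the identity) and ARBITRARY jointly smooth fields `α, β` (scalar) and `w` (vector)
on `[0, T) × 𝕋³`, the energy density `e = ½ (A α² + ρ |w|² + B β²)` and the fluxes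
`Φᵢ = ½ (A uᵢ α² + ρ uᵢ |w|² + B uᵢ β²) + θ (ζ(ρ) + ρ ζ'(ρ)) α wᵢ + ρ ζ(ρ) β wᵢ` satisfy
`∂ₜe + Σᵢ ∂ᵢΦᵢ = Q + A α F_ρ + ρ Σⱼ wⱼ F_uⱼ + B β F_θ`, where (right-hand side, in this order)
`Q = ½ (∂ₜA + u·∇A + A div u) α² + ½ (∂ₜB + u·∇B + B div u) β² + Σᵢ ∂ᵢ(θ (ζ(ρ) + ρ ζ'(ρ))) α wᵢ
 + Σᵢ ∂ᵢ(ρ ζ(ρ)) β wᵢ` and `F_ρ = ∂ₜα + u·∇α + ρ div w`, `F_uⱼ = ∂ₜwⱼ + u·∇wⱼ + A ∂ⱼα + ζ(ρ) ∂ⱼβ`,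
`F_θ = ∂ₜβ + u·∇β + (2/3) θ ζ(ρ) div w` is the frozen-coefficient linearised operator applied to
`(α, w, β)`. [folklore] -/
theorem hsEuler_frozen_energy_identity :
    ∀ {σ T : ℝ} {ρ θ : ℝ → T3 → ℝ} {u : ℝ → T3 → V3} {ζ : ℝ → ℝ} {J : Set ℝ}
      {α β : ℝ → T3 → ℝ} {w : ℝ → T3 → V3},
    IsHardSphereEulerSolution σ T ρ u θ → IsOpen J → ContDiffOn ℝ (⊤ : ℕ∞) ζ J →
    (∀ t ∈ Ico 0 T, ∀ x, ρ t x ∈ J) →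
    Torus.IsSmoothSpaceTimeOn (Ico 0 T) α → Torus.IsSmoothSpaceTimeOn (Ico 0 T) w →
    Torus.IsSmoothSpaceTimeOn (Ico 0 T) β →
    ∀ {t : ℝ}, t ∈ Ico 0 T → ∀ x : T3,
    Torus.timeDerivWithin (Ico 0 T) (fun s y => 1 / 2 *
        (θ s y * (ζ (ρ s y) + ρ s y * deriv ζ (ρ s y)) / ρ s y * α s y ^ 2 +
          ρ s y * ‖w s y‖ ^ 2 + 3 / 2 * ρ s y / θ s y * β s y ^ 2)) t x +
      ∑ i, Torus.partialDeriv i (fun y =>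
        1 / 2 * (θ t y * (ζ (ρ t y) + ρ t y * deriv ζ (ρ t y)) / ρ t y * u t y i * α t y ^ 2 +
            ρ t y * u t y i * ‖w t y‖ ^ 2 +
            3 / 2 * ρ t y / θ t y * u t y i * β t y ^ 2) +
          θ t y * (ζ (ρ t y) + ρ t y * deriv ζ (ρ t y)) * α t y * w t y i +
          ρ t y * ζ (ρ t y) * β t y * w t y i) x =
      1 / 2 * (Torus.timeDerivWithin (Ico 0 T)
            (fun s y => θ s y * (ζ (ρ s y) + ρ s y * deriv ζ (ρ s y)) / ρ s y) t x +
          ∑ i, u t x i * Torus.partialDeriv i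
            (fun y => θ t y * (ζ (ρ t y) + ρ t y * deriv ζ (ρ t y)) / ρ t y) x +
          θ t x * (ζ (ρ t x) + ρ t x * deriv ζ (ρ t x)) / ρ t x *
            ∑ i, Torus.partialDeriv i (fun y => u t y i) x) * α t x ^ 2 +
      1 / 2 * (Torus.timeDerivWithin (Ico 0 T) (fun s y => 3 / 2 * ρ s y / θ s y) t x +
          ∑ i, u t x i * Torus.partialDeriv i (fun y => 3 / 2 * ρ t y / θ t y) x +
          3 / 2 * ρ t x / θ t x * ∑ i, Torus.partialDeriv i (fun y => u t y i) x) * β t x ^ 2 +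
      ∑ i, Torus.partialDeriv i (fun y => θ t y * (ζ (ρ t y) + ρ t y * deriv ζ (ρ t y))) x *
          α t x * w t x i +
      ∑ i, Torus.partialDeriv i (fun y => ρ t y * ζ (ρ t y)) x * β t x * w t x i +
      θ t x * (ζ (ρ t x) + ρ t x * deriv ζ (ρ t x)) / ρ t x * α t x *
        (Torus.timeDerivWithin (Ico 0 T) α t x + ∑ i, u t x i * Torus.partialDeriv i (α t) x +
          ρ t x * ∑ i, Torus.partialDeriv i (fun y => w t y i) x) +
      ρ t x * ∑ j, w t x j *
        (Torus.timeDerivWithin (Ico 0 T) (fun s y => w s y j) t x +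
          ∑ i, u t x i * Torus.partialDeriv i (fun y => w t y j) x +
          θ t x * (ζ (ρ t x) + ρ t x * deriv ζ (ρ t x)) / ρ t x * Torus.partialDeriv j (α t) x +
          ζ (ρ t x) * Torus.partialDeriv j (β t) x) +
      3 / 2 * ρ t x / θ t x * β t x *
        (Torus.timeDerivWithin (Ico 0 T) β t x + ∑ i, u t x i * Torus.partialDeriv i (β t) x +
          2 / 3 * (θ t x * ζ (ρ t x)) * ∑ i, Torus.partialDeriv i (fun y => w t y i) x) := by
  -- adapted from `hsEuler_relativeEnergy_balance` (…UniquenessIdentity): one solution, free `W`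
  intro σ T ρ θ u ζ J α β w hE hJ hζ hρJ hα hw hβ t ht x
  have hU : UniqueDiffOn ℝ (Ico (0 : ℝ) T) := uniqueDiffOn_Ico 0 T
  -- smooth slices of the solution, of the free fields, of the weights and coefficients
  have hρ1 : Torus.IsContDiff 1 (ρ t) := (hE.smooth_density.isSmooth_slice ht).isContDiff (by simp)
  have hθ1 : Torus.IsContDiff 1 (θ t) :=
    (hE.smooth_temperature.isSmooth_slice ht).isContDiff (by simp)
  have hu1 : Torus.IsContDiff 1 (u t) := (hE.smooth_velocity.isSmooth_slice ht).isContDiff (by simp)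
  have huj1 : ∀ i, Torus.IsContDiff 1 (fun y => u t y i) := fun i => isContDiff_apply_coord hu1 i
  have hα1 : Torus.IsContDiff 1 (α t) := (hα.isSmooth_slice ht).isContDiff (by simp)
  have hβ1 : Torus.IsContDiff 1 (β t) := (hβ.isSmooth_slice ht).isContDiff (by simp)
  have hw1 : Torus.IsContDiff 1 (w t) := (hw.isSmooth_slice ht).isContDiff (by simp)
  have hwj1 : ∀ i, Torus.IsContDiff 1 (fun y => w t y i) := fun i => isContDiff_apply_coord hw1 i
  have hζ1 : Torus.IsContDiff 1 (fun y => ζ (ρ t y)) :=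
    (hζ.of_le (by simp)).comp_contDiff hρ1 fun v => hρJ t ht _
  have hζd1 : Torus.IsContDiff 1 (fun y => deriv ζ (ρ t y)) :=
    ((hζ.deriv_of_isOpen (m := ∞) hJ le_rfl).of_le (by simp)).comp_contDiff hρ1 fun v => hρJ t ht _
  have hAf := isSmoothSpaceTimeOn_weightA hE hJ hζ hρJ
  have hBf := isSmoothSpaceTimeOn_weightB hE
  have hA1 : Torus.IsContDiff 1
      (fun y => θ t y * (ζ (ρ t y) + ρ t y * deriv ζ (ρ t y)) / ρ t y) :=
    (hAf.isSmooth_slice ht).isContDiff (by simp)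
  have hB1 : Torus.IsContDiff 1 (fun y => 3 / 2 * ρ t y / θ t y) :=
    (hBf.isSmooth_slice ht).isContDiff (by simp)
  have hpr1 : Torus.IsContDiff 1 (fun y => θ t y * (ζ (ρ t y) + ρ t y * deriv ζ (ρ t y))) :=
    (ContDiff.mul hθ1 (ContDiff.add hζ1 (ContDiff.mul hρ1 hζd1)) :)
  have hph1 : Torus.IsContDiff 1 (fun y => ρ t y * ζ (ρ t y)) := (hρ1.mul hζ1 :)
  -- coordinate-line derivatives at `x`
  have cρ := fun i => hasDerivAt_coordLine hρ1 x i
  have cu := fun i k => hasDerivAt_coordLine (huj1 k) x i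
  have cα := fun i => hasDerivAt_coordLine hα1 x i
  have cβ := fun i => hasDerivAt_coordLine hβ1 x i
  have cw := fun i k => hasDerivAt_coordLine (hwj1 k) x i
  have cA := fun i => hasDerivAt_coordLine hA1 x i
  have cB := fun i => hasDerivAt_coordLine hB1 x i
  have cpr := fun i => hasDerivAt_coordLine hpr1 x i
  have cph := fun i => hasDerivAt_coordLine hph1 x i
  -- time-slice derivatives at `x`
  have sρ := hE.smooth_density.hasDerivWithinAt_slice ht x
  have sα := hα.hasDerivWithinAt_slice ht x
  have sβ := hβ.hasDerivWithinAt_slice ht x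
  have sw := fun k => (hw.apply k).hasDerivWithinAt_slice ht x
  have sA := hAf.hasDerivWithinAt_slice ht x
  have sB := hBf.hasDerivWithinAt_slice ht x
  -- `|w|²` in coordinates
  have hnorm : ∀ s y, ‖w s y‖ ^ 2 = (w s y 0) ^ 2 + (w s y 1) ^ 2 + (w s y 2) ^ 2 := by
    intro s y
    simp only [EuclideanSpace.norm_sq_eq, Fin.sum_univ_three, Real.norm_eq_abs, sq_abs]
  simp only [hnorm]
  -- (1) the time derivative of the energy density
  rw [timeDerivWithin_eq_of_hasDerivWithinAt ((((sA.fun_mul (sα.fun_pow 2)).fun_add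
    (sρ.fun_mul ((((sw 0).fun_pow 2).fun_add ((sw 1).fun_pow 2)).fun_add
      ((sw 2).fun_pow 2)))).fun_add (sB.fun_mul (sβ.fun_pow 2))).const_mul (1 / 2)) (hU t ht)]
  -- (2) the divergence of the flux, coordinate by coordinate
  have hΦ : ∀ i, Torus.partialDeriv i (fun y =>
      1 / 2 * (θ t y * (ζ (ρ t y) + ρ t y * deriv ζ (ρ t y)) / ρ t y * u t y i * α t y ^ 2 +
          ρ t y * u t y i * ((w t y 0) ^ 2 + (w t y 1) ^ 2 + (w t y 2) ^ 2) +
          3 / 2 * ρ t y / θ t y * u t y i * β t y ^ 2) +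
        θ t y * (ζ (ρ t y) + ρ t y * deriv ζ (ρ t y)) * α t y * w t y i +
        ρ t y * ζ (ρ t y) * β t y * w t y i) x =
      1 / 2 * ((Torus.partialDeriv i
                (fun y => θ t y * (ζ (ρ t y) + ρ t y * deriv ζ (ρ t y)) / ρ t y) x * u t x i +
              θ t x * (ζ (ρ t x) + ρ t x * deriv ζ (ρ t x)) / ρ t x *
                Torus.partialDeriv i (fun y => u t y i) x) * α t x ^ 2 +
          θ t x * (ζ (ρ t x) + ρ t x * deriv ζ (ρ t x)) / ρ t x * u t x i *
            (2 * α t x * Torus.partialDeriv i (α t) x) +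
          ((Torus.partialDeriv i (ρ t) x * u t x i +
              ρ t x * Torus.partialDeriv i (fun y => u t y i) x) *
            ((w t x 0) ^ 2 + (w t x 1) ^ 2 + (w t x 2) ^ 2) +
          ρ t x * u t x i * (2 * w t x 0 * Torus.partialDeriv i (fun y => w t y 0) x +
            2 * w t x 1 * Torus.partialDeriv i (fun y => w t y 1) x +
            2 * w t x 2 * Torus.partialDeriv i (fun y => w t y 2) x)) +
          ((Torus.partialDeriv i (fun y => 3 / 2 * ρ t y / θ t y) x * u t x i +
              3 / 2 * ρ t x / θ t x * Torus.partialDeriv i (fun y => u t y i) x) * β t x ^ 2 +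
            3 / 2 * ρ t x / θ t x * u t x i * (2 * β t x * Torus.partialDeriv i (β t) x))) +
        (Torus.partialDeriv i (fun y => θ t y * (ζ (ρ t y) + ρ t y * deriv ζ (ρ t y))) x *
            α t x * w t x i +
          θ t x * (ζ (ρ t x) + ρ t x * deriv ζ (ρ t x)) *
            (Torus.partialDeriv i (α t) x * w t x i +
              α t x * Torus.partialDeriv i (fun y => w t y i) x)) +
        (Torus.partialDeriv i (fun y => ρ t y * ζ (ρ t y)) x * β t x * w t x i +
          ρ t x * ζ (ρ t x) *
            (Torus.partialDeriv i (β t) x * w t x i +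
              β t x * Torus.partialDeriv i (fun y => w t y i) x)) := by
    intro i
    exact partialDeriv_eq_of_hasDerivAt (((((((cA i).fun_mul (cu i i)).fun_mul
      ((cα i).fun_pow 2)).fun_add (((cρ i).fun_mul (cu i i)).fun_mul (((((cw i 0).fun_pow 2).fun_add
        ((cw i 1).fun_pow 2)).fun_add ((cw i 2).fun_pow 2))))).fun_add
      (((cB i).fun_mul (cu i i)).fun_mul ((cβ i).fun_pow 2))).const_mul (1 / 2) |>.fun_add
      (((cpr i).fun_mul (cα i)).fun_mul (cw i i)) |>.fun_add
      (((cph i).fun_mul (cβ i)).fun_mul (cw i i))).congr_deriv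
      (by simp only [zero_smul, Torus.proj_zero, add_zero]; ring))
  simp only [hΦ]
  -- (3) the mass equation and the symmetriser relations
  have hP1 := hsEuler_density_eq hE ht x
  have hρ0 : ρ t x ≠ 0 := (hE.density_pos t ht x).ne'
  have hθ0 : θ t x ≠ 0 := (hE.temperature_pos t ht x).ne'
  have hA : θ t x * (ζ (ρ t x) + ρ t x * deriv ζ (ρ t x)) / ρ t x * ρ t x =
      θ t x * (ζ (ρ t x) + ρ t x * deriv ζ (ρ t x)) := div_mul_cancel₀ _ hρ0
  have hB : 2 * (3 / 2 * ρ t x / θ t x) * θ t x = 3 * ρ t x := by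
    field_simp
  simp only [Fin.sum_univ_three] at hP1
  repeat rw [Fin.sum_univ_three]
  linear_combination
    1 / 2 * ((w t x 0) ^ 2 + (w t x 1) ^ 2 + (w t x 2) ^ 2) * hP1 -
    (α t x * (Torus.partialDeriv 0 (fun y => w t y 0) x + Torus.partialDeriv 1 (fun y => w t y 1) x +
        Torus.partialDeriv 2 (fun y => w t y 2) x) +
      (w t x 0 * Torus.partialDeriv 0 (α t) x + w t x 1 * Torus.partialDeriv 1 (α t) x +
        w t x 2 * Torus.partialDeriv 2 (α t) x)) * hA -
    1 / 3 * ζ (ρ t x) * β t x * (Torus.partialDeriv 0 (fun y => w t y 0) x +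
      Torus.partialDeriv 1 (fun y => w t y 1) x + Torus.partialDeriv 2 (fun y => w t y 2) x) * hB

end Frozen

end Summit.AtomisticToContinuum.HydrodynamicLimit.Theorems

end
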